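import Literature.Computability.Complexity.MachinPiFP
import Mathlib.Analysis.SpecialFunctions.Integrals.Basic
import Mathlib.Analysis.Complex.ExponentialBounds
import Mathlib.Analysis.Real.Pi.Bounds
import HarnessLib

/-!
# Gaussian integrals `∫₀ˣ e^{-πt²/S} dt` to any dyadic precision in polynomial time

Topic `Computability/Complexity`, sequel of `MachinPiFP.lean` (`π` to `p` bits). The finite-precision
machines of the lattice/`LWE` trunk (Regev 2009, §3.1–3.2: the bootstrapping sampler of Lemma 3.2, the
Gaussian noise of Lemma 3.11, the "one-dimensional Gaussian state" of Lemma 3.12 created "using a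
technique by Grover and Rudolph … it suffices to be able to compute … the sum `Σ_{x=a}^b e^{-π(x/r)²}`
to within good precision … using the same standard techniques used in sampling from the normal
distribution") all reduce to ONE numerical primitive: the Gaussian integral

  `G(c, x) = ∫₀ˣ e^{-c t²} dt`,   `c = π/S`,

at integer (or rational) points `x`, to absolute precision `2⁻ᵖ`. This file provides it:

* `GaussIntegral.gaussF c x` (the integral) with its elementary calculus: `gaussF_zero`, oddness
  `gaussF_neg`, additivity `gaussF_sub` (`∫ₐᵇ = G(b) − G(a)`), monotonicity and the bounds
  `0 ≤ G(c, x) ≤ x` (`x ≥ 0`), and the **parameter perturbation**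
  `|G(c, x) − G(c', x)| ≤ |c − c'|·x³/3` (`abs_gaussF_sub_gaussF_le`; from `1 − e^{-d} ≤ d`) — used
  with `c = π/S`, `c' = π̃/S`;
* the **Taylor evaluation** `GaussIntegral.gaussPoly c K x = Σ_{k<K} (−c)ᵏ x^{2k+1}/(k!(2k+1))`
  (`= ∫₀ˣ` of the degree-`K` Taylor polynomial of `e^{-ct²}`, `integral_expTaylor`) and the
  **truncation bound** `abs_gaussF_sub_gaussPoly_le`: `|G(c,x) − gaussPoly c K x| ≤ x · 2Uᴷ/K!` when
  `c x² ≤ U` and `2U ≤ K + 1` (Mathlib's `Complex.exp_bound'`, integrated), with the factorial estimate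
  `pow_div_factorial_le_half_pow`: `Uᴷ/K! ≤ 2⁻ᴷ` once `K ≥ 6U` (`(K/3)ᴷ ≤ K!` from `(1 + 1/K)ᴷ ≤ e ≤ 3`);
* the **exact rational evaluator** `GaussIntegral.gaussSeriesQ a b u v K = gaussPoly (a/b) K (u/v)`
  (`cast_gaussSeriesQ`) and the packaged approximation **`GaussIntegral.gaussFApprox S u p U`**
  (`π̃ = piApprox (p + 3B + 1)`, `B = |bin |u||`, `K = 6U + p + B + 2` terms) with
  **`abs_gaussF_sub_gaussFApprox_le`**: for `S ≥ 1` and `4u² ≤ U·S`,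
  `|G(π/S, u) − gaussFApprox S u p U| ≤ 2⁻ᵖ`;
* **polynomial time** (typed `CodeFP`, no machine written): `codeFP_natFactorial` (`1ᴷ ↦ K!`),
  `codeFP_gaussSeriesQ`, **`codeFP_gaussFApprox`** — on the code `⟨⟨S, u⟩, ⟨1ᵖ, 1ᵁ⟩⟩` (the caller
  supplies the unary budget `U ≥ 4u²/S`, which is `≤ 4n` on the cores `|u| ≤ √(nS)` where the lattice
  machines evaluate it; a budget read off a binary numeral would not be polynomial).

Everything here is proved; definitions have bodies; no named fact is introduced.

## References

* O. Regev, *On lattices, learning with errors, random linear codes, and cryptography*, J. ACM 56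
  (2009), art. 34, §2 (p. 11) and Lemma 3.12 (proof) [Regev2009].
* L. Grover, T. Rudolph, *Creating superpositions that correspond to efficiently integrable probability
  distributions*, arXiv:quant-ph/0208112 (2002) [GroverRudolph2002].
* M. Abramowitz, I. A. Stegun, *Handbook of Mathematical Functions*, NBS 1964, 7.1.5 (the Maclaurin
  series of `erf`) [AbramowitzStegun1964].
* K.-I. Ko, *Complexity Theory of Real Functions*, Birkhäuser 1991, §2 [Ko1991].
-/

noncomputable section

namespace Literature.Computability.Complexity

open _root_.Computability Finset intervalIntegral
open Literature.Algebra.EuclideanLattices (encodeRat)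

namespace GaussIntegral

/-! ### The Gaussian integral and its elementary calculus -/

/-- **`G(c, x) = ∫₀ˣ e^{-ct²} dt`.** [cite: AbramowitzStegun1964, 7.1.1] -/
def gaussF (c x : ℝ) : ℝ := ∫ t in (0 : ℝ)..x, Real.exp (-(c * t ^ 2))

/-- The integrand is continuous. [folklore] -/
theorem continuous_integrand (c : ℝ) : Continuous fun t : ℝ => Real.exp (-(c * t ^ 2)) := by
  fun_prop

/-- The integrand is interval integrable. [folklore] -/
theorem intervalIntegrable_integrand (c a b : ℝ) :
    IntervalIntegrable (fun t : ℝ => Real.exp (-(c * t ^ 2))) MeasureTheory.volume a b :=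
  (continuous_integrand c).intervalIntegrable a b

/-- `G(c, 0) = 0`. [folklore] -/
@[simp] theorem gaussF_zero (c : ℝ) : gaussF c 0 = 0 := by
  simp [gaussF]

/-- **Oddness**: `G(c, −x) = −G(c, x)` (the integrand is even). [cite: AbramowitzStegun1964, 7.1.9] -/
theorem gaussF_neg (c x : ℝ) : gaussF c (-x) = -gaussF c x := by
  unfold gaussF
  have h := intervalIntegral.integral_comp_neg (a := (0 : ℝ)) (b := -x) (fun t : ℝ => Real.exp (-(c * t ^ 2)))
  simp only [even_two, Even.neg_pow, neg_neg, neg_zero] at h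
  rw [h, intervalIntegral.integral_symm]

/-- **Additivity**: `∫ₐᵇ e^{-ct²} dt = G(c, b) − G(c, a)`. [folklore] -/
theorem gaussF_sub (c a b : ℝ) :
    gaussF c b - gaussF c a = ∫ t in a..b, Real.exp (-(c * t ^ 2)) := by
  unfold gaussF
  rw [intervalIntegral.integral_interval_sub_left (intervalIntegrable_integrand c 0 b)
    (intervalIntegrable_integrand c 0 a)]

/-- `0 ≤ G(c, x)` for `x ≥ 0`. [folklore] -/
theorem gaussF_nonneg (c : ℝ) {x : ℝ} (hx : 0 ≤ x) : 0 ≤ gaussF c x :=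
  intervalIntegral.integral_nonneg hx fun _ _ => (Real.exp_pos _).le

/-- `G(c, x) ≤ x` for `x ≥ 0` and `c ≥ 0` (the integrand is at most `1`). [folklore] -/
theorem gaussF_le_self {c x : ℝ} (hc : 0 ≤ c) (hx : 0 ≤ x) : gaussF c x ≤ x := by
  unfold gaussF
  have h := intervalIntegral.integral_mono_on hx (intervalIntegrable_integrand c 0 x)
    (intervalIntegrable_const (c := (1 : ℝ)) (μ := MeasureTheory.volume) (a := 0) (b := x))
    (fun t _ => by
      rw [Real.exp_le_one_iff, neg_nonpos]
      exact mul_nonneg hc (sq_nonneg t))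
  simpa using h

/-- **Monotonicity in `x`** (`x ≥ 0`): `G(c, a) ≤ G(c, b)` for `0 ≤ a ≤ b`. [folklore] -/
theorem gaussF_mono (c : ℝ) {a b : ℝ} (hab : a ≤ b) : gaussF c a ≤ gaussF c b := by
  have h := gaussF_sub c a b
  have hpos : 0 ≤ ∫ t in a..b, Real.exp (-(c * t ^ 2)) :=
    intervalIntegral.integral_nonneg hab fun _ _ => (Real.exp_pos _).le
  linarith

/-- `1 − e^{-d} ≤ d` for `d ≥ 0`. [folklore] -/
theorem one_sub_exp_neg_le {d : ℝ} : 1 - Real.exp (-d) ≤ d := by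
  have := Real.add_one_le_exp (-d)
  linarith

/-- Pointwise perturbation of the integrand: `0 ≤ e^{-ct²} − e^{-c't²} ≤ (c' − c) t²` for
`0 ≤ c ≤ c'`. [folklore] -/
theorem exp_sub_exp_le {c c' : ℝ} (hc : 0 ≤ c) (hcc : c ≤ c') (t : ℝ) :
    Real.exp (-(c * t ^ 2)) - Real.exp (-(c' * t ^ 2)) ≤ (c' - c) * t ^ 2 := by
  have hfac : Real.exp (-(c' * t ^ 2)) = Real.exp (-(c * t ^ 2)) * Real.exp (-((c' - c) * t ^ 2)) := by
    rw [← Real.exp_add]; congr 1; ring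
  rw [hfac, ← mul_one_sub]
  have hd : 0 ≤ (c' - c) * t ^ 2 := mul_nonneg (by linarith) (sq_nonneg t)
  have h2 : 1 - Real.exp (-((c' - c) * t ^ 2)) ≤ (c' - c) * t ^ 2 := one_sub_exp_neg_le
  have h3 : 0 ≤ 1 - Real.exp (-((c' - c) * t ^ 2)) := by
    rw [sub_nonneg, Real.exp_le_one_iff, neg_nonpos]; exact hd
  have h4 : Real.exp (-(c * t ^ 2)) ≤ 1 := by
    rw [Real.exp_le_one_iff, neg_nonpos]; exact mul_nonneg hc (sq_nonneg t)
  calc Real.exp (-(c * t ^ 2)) * (1 - Real.exp (-((c' - c) * t ^ 2)))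
      ≤ 1 * ((c' - c) * t ^ 2) := by gcongr
    _ = (c' - c) * t ^ 2 := one_mul _

/-- Pointwise monotonicity of the integrand in the parameter: `e^{-c't²} ≤ e^{-ct²}` for `c ≤ c'`. [folklore] -/
theorem exp_le_exp_of_le {c c' : ℝ} (hcc : c ≤ c') (t : ℝ) :
    Real.exp (-(c' * t ^ 2)) ≤ Real.exp (-(c * t ^ 2)) := by
  rw [Real.exp_le_exp, neg_le_neg_iff]
  exact mul_le_mul_of_nonneg_right hcc (sq_nonneg t)

/-- **Parameter perturbation**: `0 ≤ G(c, x) − G(c', x) ≤ (c' − c) x³/3` for `0 ≤ c ≤ c'`, `x ≥ 0`.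
[folklore] -/
theorem gaussF_sub_gaussF_mem {c c' x : ℝ} (hc : 0 ≤ c) (hcc : c ≤ c') (hx : 0 ≤ x) :
    0 ≤ gaussF c x - gaussF c' x ∧ gaussF c x - gaussF c' x ≤ (c' - c) * x ^ 3 / 3 := by
  unfold gaussF
  rw [← intervalIntegral.integral_sub (intervalIntegrable_integrand c 0 x) (intervalIntegrable_integrand c' 0 x)]
  constructor
  · exact intervalIntegral.integral_nonneg hx fun t _ => sub_nonneg.2 (exp_le_exp_of_le hcc t)
  · have hint : IntervalIntegrable (fun t : ℝ => (c' - c) * t ^ 2) MeasureTheory.volume 0 x :=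
      (by fun_prop : Continuous fun t : ℝ => (c' - c) * t ^ 2).intervalIntegrable 0 x
    have h := intervalIntegral.integral_mono_on hx
      ((intervalIntegrable_integrand c 0 x).sub (intervalIntegrable_integrand c' 0 x)) hint
      (fun t _ => exp_sub_exp_le hc hcc t)
    refine h.trans (le_of_eq ?_)
    rw [intervalIntegral.integral_const_mul, integral_pow]
    ring

/-- **`|G(c, x) − G(c', x)| ≤ |c − c'| x³/3`** for `c, c' ≥ 0`, `x ≥ 0`. [folklore] -/
theorem abs_gaussF_sub_gaussF_le {c c' x : ℝ} (hc : 0 ≤ c) (hc' : 0 ≤ c') (hx : 0 ≤ x) :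
    |gaussF c x - gaussF c' x| ≤ |c - c'| * x ^ 3 / 3 := by
  rcases le_total c c' with h | h
  · obtain ⟨h0, h1⟩ := gaussF_sub_gaussF_mem hc h hx
    rw [abs_of_nonneg h0, abs_sub_comm, abs_of_nonneg (sub_nonneg.2 h)]
    exact h1
  · obtain ⟨h0, h1⟩ := gaussF_sub_gaussF_mem hc' h hx
    rw [abs_sub_comm, abs_of_nonneg h0, abs_of_nonneg (sub_nonneg.2 h)]
    exact h1

/-! ### Taylor evaluation and its truncation error -/

/-- The degree-`K` Taylor polynomial of `exp`: `Σ_{k<K} uᵏ/k!`. [folklore] -/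
def expTaylor (K : ℕ) (u : ℝ) : ℝ := ∑ k ∈ range K, u ^ k / k.factorial

/-- **`|eᵘ − expTaylor K u| ≤ 2|u|ᴷ/K!` when `2|u| ≤ K + 1`** (Mathlib's `Complex.exp_bound'`).
[folklore] -/
theorem abs_exp_sub_expTaylor_le {u : ℝ} {K : ℕ} (h : 2 * |u| ≤ K + 1) :
    |Real.exp u - expTaylor K u| ≤ 2 * |u| ^ K / K.factorial := by
  have hx : ‖(u : ℂ)‖ / (K.succ : ℕ) ≤ 1 / 2 := by
    rw [Complex.norm_real, Real.norm_eq_abs, Nat.cast_succ, div_le_div_iff₀ (by positivity) (by norm_num)]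
    linarith
  have hb := Complex.exp_bound' (x := (u : ℂ)) (n := K) hx
  have hre : ((Real.exp u - expTaylor K u : ℝ) : ℂ) = Complex.exp (u : ℂ) - ∑ m ∈ range K, (u : ℂ) ^ m / (m.factorial : ℂ) := by
    simp [expTaylor, Complex.ofReal_exp]
  rw [← hre, Complex.norm_real, Real.norm_eq_abs, Complex.norm_real, Real.norm_eq_abs] at hb
  calc |Real.exp u - expTaylor K u| ≤ |u| ^ K / K.factorial * 2 := hb
    _ = 2 * |u| ^ K / K.factorial := by ring

/-- **The integrated Taylor polynomial**: `gaussPoly c K x = Σ_{k<K} (−c)ᵏ x^{2k+1}/(k!(2k+1))`, the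
Maclaurin polynomial of `G(c, ·)`. [cite: AbramowitzStegun1964, 7.1.5] -/
def gaussPoly (c : ℝ) (K : ℕ) (x : ℝ) : ℝ :=
  ∑ k ∈ range K, (-c) ^ k * x ^ (2 * k + 1) / ((k.factorial : ℝ) * (2 * k + 1))

/-- `∫₀ˣ Σ_{k<K} (−ct²)ᵏ/k! dt = gaussPoly c K x` (termwise `∫₀ˣ t^{2k} dt = x^{2k+1}/(2k+1)`). [cite: AbramowitzStegun1964, 7.1.5] -/
theorem integral_expTaylor (c x : ℝ) (K : ℕ) :
    ∫ t in (0 : ℝ)..x, expTaylor K (-(c * t ^ 2)) = gaussPoly c K x := by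
  unfold expTaylor gaussPoly
  rw [intervalIntegral.integral_finsetSum]
  · refine sum_congr rfl fun k _ => ?_
    have hfun : (fun t : ℝ => (-(c * t ^ 2)) ^ k / (k.factorial : ℝ)) = fun t => ((-c) ^ k / k.factorial) * t ^ (2 * k) := by
      funext t
      rw [show -(c * t ^ 2) = (-c) * t ^ 2 by ring, mul_pow, ← pow_mul]
      ring
    rw [hfun, intervalIntegral.integral_const_mul, integral_pow]
    have hk : ((2 * k : ℕ) : ℝ) + 1 ≠ 0 := by positivity
    have hk' : (k.factorial : ℝ) ≠ 0 := by positivity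
    rw [zero_pow (by omega), sub_zero]
    push_cast
    field_simp
  · intro k _
    exact (by fun_prop : Continuous fun t : ℝ => (-(c * t ^ 2)) ^ k / (k.factorial : ℝ)).intervalIntegrable _ _

/-- **Truncation bound**: for `0 ≤ x`, `0 ≤ c`, `c x² ≤ U` and `2U ≤ K + 1`,
`|G(c, x) − gaussPoly c K x| ≤ x · (2 Uᴷ/K!)`. [cite: AbramowitzStegun1964, 7.1.5] -/
theorem abs_gaussF_sub_gaussPoly_le {c x U : ℝ} {K : ℕ} (hc : 0 ≤ c) (hx : 0 ≤ x) (hU : c * x ^ 2 ≤ U)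
    (hK : 2 * U ≤ K + 1) : |gaussF c x - gaussPoly c K x| ≤ x * (2 * U ^ K / K.factorial) := by
  have hU0 : 0 ≤ U := le_trans (mul_nonneg hc (sq_nonneg x)) hU
  have hsub : gaussF c x - gaussPoly c K x =
      ∫ t in (0 : ℝ)..x, (Real.exp (-(c * t ^ 2)) - expTaylor K (-(c * t ^ 2))) := by
    rw [intervalIntegral.integral_sub (intervalIntegrable_integrand c 0 x)
      ((by unfold expTaylor; fun_prop : Continuous fun t : ℝ => expTaylor K (-(c * t ^ 2))).intervalIntegrable 0 x),
      integral_expTaylor]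
    rfl
  rw [hsub]
  have hb := intervalIntegral.norm_integral_le_of_norm_le_const (a := (0 : ℝ)) (b := x)
    (C := 2 * U ^ K / K.factorial) (f := fun t => Real.exp (-(c * t ^ 2)) - expTaylor K (-(c * t ^ 2)))
    (fun t ht => by
      rw [Set.uIoc_of_le hx, Set.mem_Ioc] at ht
      have ht2 : t ^ 2 ≤ x ^ 2 := by nlinarith [ht.1, ht.2]
      have hct : c * t ^ 2 ≤ U := (mul_le_mul_of_nonneg_left ht2 hc).trans hU
      have habs : |(-(c * t ^ 2))| = c * t ^ 2 := by
        rw [abs_neg, abs_of_nonneg (mul_nonneg hc (sq_nonneg t))]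
      have h2 : 2 * |(-(c * t ^ 2))| ≤ K + 1 := by rw [habs]; linarith
      rw [Real.norm_eq_abs]
      refine (abs_exp_sub_expTaylor_le h2).trans ?_
      rw [habs]
      gcongr)
  rw [Real.norm_eq_abs, sub_zero, abs_of_nonneg hx] at hb
  linarith [hb]

/-! ### The factorial estimate -/

/-- `(1 + 1/K)ᴷ ≤ 3`. [folklore] -/
theorem one_add_inv_pow_le_three (K : ℕ) (hK : 0 < K) : (1 + 1 / (K : ℝ)) ^ K ≤ 3 := by
  have h1 : 1 + 1 / (K : ℝ) ≤ Real.exp (1 / K) := by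
    have := Real.add_one_le_exp (1 / (K : ℝ)); linarith
  have h0 : 0 ≤ 1 + 1 / (K : ℝ) := by positivity
  calc (1 + 1 / (K : ℝ)) ^ K ≤ Real.exp (1 / K) ^ K := pow_le_pow_left₀ h0 h1 K
    _ = Real.exp 1 := by
        rw [← Real.exp_nat_mul]; congr 1
        field_simp
    _ ≤ 3 := by have := Real.exp_one_lt_d9; linarith

/-- **`(K/3)ᴷ ≤ K!`.** [folklore] -/
theorem div_three_pow_le_factorial (K : ℕ) : ((K : ℝ) / 3) ^ K ≤ K.factorial := by
  induction K with
  | zero => simp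
  | succ K ih =>
    rcases Nat.eq_zero_or_pos K with hK | hK
    · subst hK; norm_num
    · have hK' : (0 : ℝ) < K := by exact_mod_cast hK
      have hratio : (((K + 1 : ℕ) : ℝ) / 3) ^ K = ((K : ℝ) / 3) ^ K * (1 + 1 / (K : ℝ)) ^ K := by
        rw [← mul_pow]; congr 1
        push_cast
        field_simp
      calc (((K + 1 : ℕ) : ℝ) / 3) ^ (K + 1)
          = ((K + 1 : ℕ) : ℝ) / 3 * ((((K + 1 : ℕ) : ℝ) / 3) ^ K) := by rw [pow_succ]; ring
        _ = ((K + 1 : ℕ) : ℝ) / 3 * (((K : ℝ) / 3) ^ K * (1 + 1 / (K : ℝ)) ^ K) := by rw [hratio]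
        _ ≤ ((K + 1 : ℕ) : ℝ) / 3 * ((K.factorial : ℝ) * 3) := by
            gcongr
            exact one_add_inv_pow_le_three K hK
        _ = ((K + 1).factorial : ℝ) := by
            rw [Nat.factorial_succ]; push_cast; ring

/-- **`Uᴷ/K! ≤ 2⁻ᴷ` once `6U ≤ K`** (`U ≥ 0`). [folklore] -/
theorem pow_div_factorial_le_half_pow {U : ℝ} {K : ℕ} (hU : 0 ≤ U) (hK : 6 * U ≤ K) :
    U ^ K / K.factorial ≤ (1 / 2 : ℝ) ^ K := by
  rcases Nat.eq_zero_or_pos K with hK0 | hK0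
  · subst hK0; simp
  · have hKpos : (0 : ℝ) < K := by exact_mod_cast hK0
    have hfac : (0 : ℝ) < K.factorial := by exact_mod_cast Nat.factorial_pos K
    have h3 : (0 : ℝ) < ((K : ℝ) / 3) ^ K := by positivity
    calc U ^ K / K.factorial ≤ U ^ K / ((K : ℝ) / 3) ^ K := by
          gcongr
          exact div_three_pow_le_factorial K
      _ = (3 * U / K) ^ K := by rw [← div_pow]; congr 1; field_simp
      _ ≤ (1 / 2 : ℝ) ^ K := by
          apply pow_le_pow_left₀ (by positivity)
          rw [div_le_div_iff₀ hKpos (by norm_num)]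
          linarith

/-! ### The exact rational evaluator -/

/-- The `k`-th term of the rational evaluation with `c = a/b`, `x = u/v`:
`((−1)ᵏ aᵏ u^{2k+1}) / (bᵏ v^{2k+1} k! (2k+1))`. [cite: AbramowitzStegun1964, 7.1.5] -/
def seriesTermQ (a b u v : ℕ) (k : ℕ) : ℚ :=
  (((-1 : ℤ) ^ k * ((a ^ k * u ^ (2 * k + 1) : ℕ) : ℤ) : ℤ) : ℚ) /
    ((b ^ k * v ^ (2 * k + 1) * k.factorial * (2 * k + 1) : ℕ) : ℚ)

/-- **The exact rational evaluator** of `gaussPoly (a/b) K (u/v)`. [cite: AbramowitzStegun1964, 7.1.5] -/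
def gaussSeriesQ (a b u v : ℕ) (K : ℕ) : ℚ := ((List.range K).map (seriesTermQ a b u v)).sum

/-- The rational term is the term of `gaussPoly`. [folklore] -/
theorem cast_seriesTermQ (a b : ℕ) (hb : 0 < b) (u v : ℕ) (hv : 0 < v) (k : ℕ) :
    ((seriesTermQ a b u v k : ℚ) : ℝ) =
      (-((a : ℝ) / b)) ^ k * ((u : ℝ) / v) ^ (2 * k + 1) / ((k.factorial : ℝ) * (2 * k + 1)) := by
  unfold seriesTermQ
  have hb' : (b : ℝ) ≠ 0 := by exact_mod_cast hb.ne'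
  have hv' : (v : ℝ) ≠ 0 := by exact_mod_cast hv.ne'
  have hf : (k.factorial : ℝ) ≠ 0 := by positivity
  have hk : (2 * (k : ℝ) + 1) ≠ 0 := by positivity
  have e1 : (-((a : ℝ) / b)) ^ k = (-1) ^ k * (a : ℝ) ^ k / (b : ℝ) ^ k := by rw [neg_pow, div_pow]; ring
  push_cast
  rw [e1]
  simp only [div_pow]
  field_simp

/-- **`gaussSeriesQ a b u v K = gaussPoly (a/b) K (u/v)`** (cast to `ℝ`). [folklore] -/
theorem cast_gaussSeriesQ (a b : ℕ) (hb : 0 < b) (u v : ℕ) (hv : 0 < v) (K : ℕ) :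
    ((gaussSeriesQ a b u v K : ℚ) : ℝ) = gaussPoly ((a : ℝ) / b) K ((u : ℝ) / v) := by
  unfold gaussSeriesQ gaussPoly
  induction K with
  | zero => simp
  | succ K ih =>
    rw [List.range_succ, List.map_append, List.sum_append, List.map_singleton, List.sum_singleton,
      Rat.cast_add, ih, sum_range_succ, cast_seriesTermQ a b hb u v hv]

/-! ### The packaged approximation of `G(π/S, u)` -/

open MachinPi

/-- `2 ≤ piApprox p ≤ 4` (from `|π − piApprox p| ≤ 1/2` and `3.14 < π < 3.15`). [folklore] -/
theorem piApprox_mem (p : ℕ) : (2 : ℝ) ≤ piApprox p ∧ (piApprox p : ℝ) ≤ 4 := by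
  have h := abs_pi_sub_piApprox_le p
  have h2 : 1 / (2 * (2 : ℝ) ^ p) ≤ 1 / 2 := by
    apply div_le_div_of_nonneg_left (by norm_num) (by norm_num)
    have : (1 : ℝ) ≤ 2 ^ p := one_le_pow₀ (by norm_num)
    linarith
  rw [abs_le] at h
  constructor <;> nlinarith [Real.pi_gt_d2, Real.pi_lt_d2, h.1, h.2]

/-- `0 < piApprox p`. [folklore] -/
theorem piApprox_pos (p : ℕ) : 0 < piApprox p := by
  have h := (piApprox_mem p).1
  have : (0 : ℝ) < piApprox p := by linarith
  exact_mod_cast this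

/-- **The approximation of `G(π/S, u)` at precision `p` with budget `U`**: the rational Taylor value
with `π̃ = piApprox (p + 3B + 1)` (`B = |bin |u||`) in place of `π` and `K = 6U + p + B + 2` terms.
[cite: Regev2009, §2 (p. 11)] -/
def gaussFApprox (S : ℚ) (u p U : ℕ) : ℚ :=
  gaussSeriesQ (piApprox (p + 3 * Nat.size u + 1) / S).num.natAbs (piApprox (p + 3 * Nat.size u + 1) / S).den
    u 1 (6 * U + p + Nat.size u + 2)

/-- `u < 2^{size u}` as reals. [folklore] -/
theorem lt_two_pow_size (u : ℕ) : (u : ℝ) < (2 : ℝ) ^ Nat.size u := by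
  exact_mod_cast Nat.lt_size_self u

/-- **`|G(π/S, u) − gaussFApprox S u p U| ≤ 2⁻ᵖ`** for `S ≥ 1` and `4u² ≤ U·S`.
[cite: Regev2009, §2 (p. 11)] [cite: AbramowitzStegun1964, 7.1.5] -/
theorem abs_gaussF_sub_gaussFApprox_le {S : ℚ} (hS : 1 ≤ S) {u U p : ℕ}
    (hU : 4 * (u : ℝ) ^ 2 ≤ U * (S : ℝ)) :
    |gaussF (Real.pi / S) u - (gaussFApprox S u p U : ℝ)| ≤ 1 / (2 : ℝ) ^ p := by
  set B : ℕ := Nat.size u with hB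
  set p' : ℕ := p + 3 * B + 1 with hp'
  set K : ℕ := 6 * U + p + B + 2 with hKdef
  set cq : ℚ := piApprox p' / S with hcq
  have hS0 : (0 : ℝ) < S := by exact_mod_cast (lt_of_lt_of_le one_pos hS)
  have hS0q : (0 : ℚ) < S := lt_of_lt_of_le one_pos hS
  have hcq0 : 0 < cq := div_pos (piApprox_pos p') hS0q
  have hux : (0 : ℝ) ≤ u := Nat.cast_nonneg u
  -- the evaluator is `gaussPoly c̃ K u`
  have hnum : ((cq.num.natAbs : ℕ) : ℝ) / (cq.den : ℕ) = (cq : ℝ) := by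
    have h2 : ((cq.num : ℚ) / (cq.den : ℚ)) = cq := Rat.num_div_den cq
    have h3 : ((cq.num.natAbs : ℕ) : ℚ) = (cq.num : ℚ) := by
      rw [Nat.cast_natAbs, Int.cast_abs, abs_of_nonneg]
      exact_mod_cast Rat.num_nonneg.2 hcq0.le
    rw [← h3] at h2
    have := congrArg (fun q : ℚ => (q : ℝ)) h2
    push_cast at this
    exact this
  have heval : (gaussFApprox S u p U : ℝ) = gaussPoly (cq : ℝ) K u := by
    unfold gaussFApprox
    rw [cast_gaussSeriesQ _ _ cq.den_pos _ _ one_pos, hnum]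
    simp only [Nat.cast_one, div_one]
    rfl
  -- the two parameters
  set c : ℝ := Real.pi / S with hc
  have hc0 : 0 ≤ c := div_nonneg Real.pi_pos.le hS0.le
  have hct : (cq : ℝ) = (piApprox p' : ℝ) / S := by rw [hcq]; push_cast; rfl
  have hcqR0 : (0 : ℝ) ≤ (cq : ℝ) := by exact_mod_cast hcq0.le
  obtain ⟨-, hpi4⟩ := piApprox_mem p'
  -- Step 1: `|G(c,u) − G(c̃,u)| ≤ |π − π̃| u³/(3S) ≤ 2^{-p'} u³ ≤ 2^{-(p+1)}`
  have hstep1 : |gaussF c u - gaussF (cq : ℝ) u| ≤ 1 / (2 * (2 : ℝ) ^ p) := by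
    refine (abs_gaussF_sub_gaussF_le hc0 hcqR0 hux).trans ?_
    have hdiff : |c - (cq : ℝ)| = |Real.pi - piApprox p'| / S := by
      rw [hc, hct, ← sub_div, abs_div, abs_of_pos hS0]
    rw [hdiff]
    have hpi := abs_pi_sub_piApprox_le p'
    have hu3 : (u : ℝ) ^ 3 ≤ ((2 : ℝ) ^ B) ^ 3 := pow_le_pow_left₀ hux (lt_two_pow_size u).le 3
    have h2B : ((2 : ℝ) ^ B) ^ 3 = 2 ^ (3 * B) := by rw [← pow_mul, mul_comm]
    calc |Real.pi - piApprox p'| / S * (u : ℝ) ^ 3 / 3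
        ≤ (1 / (2 * (2 : ℝ) ^ p')) / 1 * ((2 : ℝ) ^ (3 * B)) / 3 := by
          rw [← h2B]
          gcongr
          exact_mod_cast hS
      _ = 1 / (12 * (2 : ℝ) ^ p) := by
          rw [hp', pow_add, pow_add, pow_one]
          have h2p : (0 : ℝ) < 2 ^ p := by positivity
          have h23 : (0 : ℝ) < 2 ^ (3 * B) := by positivity
          field_simp
          ring
      _ ≤ 1 / (2 * (2 : ℝ) ^ p) := by
          apply div_le_div_of_nonneg_left (by norm_num) (by positivity)
          have h2p : (0 : ℝ) < 2 ^ p := by positivity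
          nlinarith
  -- Step 2: truncation `|G(c̃,u) − gaussPoly c̃ K u| ≤ u · 2 Uᴷ/K! ≤ 2^{B+1} 2^{-K} ≤ 2^{-(p+1)}`
  have hUc : (cq : ℝ) * (u : ℝ) ^ 2 ≤ U := by
    rw [hct]
    have : (piApprox p' : ℝ) / S * (u : ℝ) ^ 2 ≤ 4 / S * (u : ℝ) ^ 2 := by gcongr
    refine this.trans ?_
    rw [div_mul_eq_mul_div, div_le_iff₀ hS0]
    linarith
  have hU0 : (0 : ℝ) ≤ U := by positivity
  have hK2 : 2 * (U : ℝ) ≤ K + 1 := by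
    rw [hKdef]; push_cast; linarith
  have hK6 : 6 * (U : ℝ) ≤ K := by rw [hKdef]; push_cast; linarith
  have hstep2 : |gaussF (cq : ℝ) u - gaussPoly (cq : ℝ) K u| ≤ 1 / (2 * (2 : ℝ) ^ p) := by
    refine (abs_gaussF_sub_gaussPoly_le hcqR0 hux hUc hK2).trans ?_
    have hfac := pow_div_factorial_le_half_pow hU0 hK6
    have hu1 : (u : ℝ) ≤ (2 : ℝ) ^ B := (lt_two_pow_size u).le
    calc (u : ℝ) * (2 * (U : ℝ) ^ K / K.factorial) = (u : ℝ) * 2 * ((U : ℝ) ^ K / K.factorial) := by ring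
      _ ≤ (2 : ℝ) ^ B * 2 * (1 / 2 : ℝ) ^ K := by gcongr
      _ = 1 / (2 * (2 : ℝ) ^ p) * ((2 : ℝ) ^ (B + p + 2) / 2 ^ K) := by
          rw [one_div_pow]
          field_simp
          ring
      _ ≤ 1 / (2 * (2 : ℝ) ^ p) * 1 := by
          gcongr
          rw [div_le_one (by positivity)]
          exact pow_le_pow_right₀ (by norm_num) (by rw [hKdef]; omega)
      _ = 1 / (2 * (2 : ℝ) ^ p) := mul_one _
  -- combine
  rw [heval]
  calc |gaussF c u - gaussPoly (cq : ℝ) K u|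
      = |(gaussF c u - gaussF (cq : ℝ) u) + (gaussF (cq : ℝ) u - gaussPoly (cq : ℝ) K u)| := by ring_nf
    _ ≤ |gaussF c u - gaussF (cq : ℝ) u| + |gaussF (cq : ℝ) u - gaussPoly (cq : ℝ) K u| := abs_add_le _ _
    _ ≤ 1 / (2 * (2 : ℝ) ^ p) + 1 / (2 * (2 : ℝ) ^ p) := add_le_add hstep1 hstep2
    _ = 1 / (2 : ℝ) ^ p := by field_simp; ring

/-! ### Polynomial time in the unary precision and budget -/

open CodeFP

/-- `size (a + 1) ≤ size a + 1`. [folklore] -/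
theorem size_succ_le (a : ℕ) : Nat.size (a + 1) ≤ Nat.size a + 1 := by
  apply Nat.size_le.2
  have := Nat.lt_size_self a
  rw [pow_succ]; omega

/-- The product fold `Π_{a ∈ l} (a + 1)` has a numeral no longer than the code of the list plus one. [folklore] -/
theorem length_natE_foldl_mul_succ_le (l : List ℕ) (b₀ : ℕ) :
    (natE (l.foldl (fun b a => b * (a + 1)) b₀)).length ≤ (natE b₀).length + (rawE natE l).length := by
  induction l generalizing b₀ with
  | nil => simp
  | cons a l ih =>
    rw [List.foldl_cons]
    refine (ih _).trans ?_
    rw [rawE_cons, length_boolPair]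
    have h1 := length_natE_mul_le b₀ (a + 1)
    have h2 : (natE (a + 1)).length ≤ (natE a).length + 1 := by
      rw [show natE (a + 1) = encodeNat (a + 1) from rfl, show natE a = encodeNat a from rfl,
        TM2Pass.length_encodeNat_eq_size, TM2Pass.length_encodeNat_eq_size]
      exact size_succ_le a
    omega

/-- `Π_{k<K} (k + 1) = K!`. [folklore] -/
theorem foldl_mul_succ_range (K : ℕ) : (List.range K).foldl (fun b a => b * (a + 1)) 1 = K.factorial := by
  induction K with
  | zero => rfl
  | succ K ih => rw [List.range_succ, List.foldl_append, ih, List.foldl_cons, List.foldl_nil, Nat.factorial_succ]; ring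

/-- **`1ᴷ ↦ K!` is polynomial time** (a fold of multiplications over `[0, K)`; `|bin K!| ≤ |code of [0,K)| + 1`).
[cite: Ko1991, §2] -/
theorem codeFP_natFactorial : CodeFP unE natE Nat.factorial := by
  have hstep : CodeFP (pairE unE (pairE natE natE)) natE (fun t => t.2.2 * (t.2.1 + 1)) :=
    (natMul.comp ((snd _ _).snd'.pair (natAdd.comp ((snd _ _).fst'.pair (const _ 1)))) :)
  have h := foldl (σ := ℕ) (α := ℕ) (β := ℕ) (eσ := unE) (eα := natE) (eβ := natE)
    (step := fun _ a b => b * (a + 1)) (init := fun _ => 1) hstep (const unE 1) (Polynomial.X + 1)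
    (fun s l₁ l₂ => by
      refine (length_natE_foldl_mul_succ_le l₁ 1).trans ?_
      rw [Polynomial.eval_add, Polynomial.eval_X, Polynomial.eval_one, pairE_apply, length_boolPair, rawE_append,
        List.length_append]
      have h1 : (natE 1).length = 1 := by
        rw [show natE 1 = encodeNat 1 from rfl, TM2Pass.length_encodeNat_eq_size]; rfl
      omega)
  exact (h.comp ((CodeFP.id unE).pair urange)).congr fun K => by simp [foldl_mul_succ_range]

/-- `bin u ↦ 1^{size u}` (the length of the numeral, in unary). [folklore] -/
theorem codeFP_sizeUn : CodeFP natE unE Nat.size :=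
  ⟨onesFn, onesFn_mem_FP, fun n => by
    rw [onesFn, show natE n = encodeNat n from rfl, TM2Pass.length_encodeNat_eq_size]⟩

/-- The context code of the term map: `⟨1ᵂ, ⟨⟨a, b⟩, ⟨u, v⟩⟩⟩`. [folklore] -/
abbrev termCtxE : ℕ × ((ℕ × ℕ) × (ℕ × ℕ)) → List Bool := pairE unE (pairE (pairE natE natE) (pairE natE natE))

/-- **The term map is polynomial time**, in the capped form (all exponents `min · W` for the unary
budget `W` of the context; no cap takes effect when `2k + 1 ≤ W`). [cite: Ko1991, §2] -/
theorem codeFP_seriesTermCapped :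
    CodeFP (pairE termCtxE natE) encodeRat
      (fun q => (((-1 : ℤ) ^ q.2 * ((q.1.2.1.1 ^ (min q.2 q.1.1) * q.1.2.2.1 ^ (min (2 * q.2 + 1) q.1.1) : ℕ) : ℤ) : ℤ) : ℚ) /
        ((q.1.2.1.2 ^ (min q.2 q.1.1) * q.1.2.2.2 ^ (min (2 * q.2 + 1) q.1.1) * (min q.2 q.1.1).factorial * (2 * q.2 + 1) : ℕ) : ℚ)) := by
  have hk : CodeFP (pairE termCtxE natE) natE (fun q => q.2) := snd _ _
  have hW : CodeFP (pairE termCtxE natE) unE (fun q => q.1.1) := (fst _ _).fst'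
  have ha : CodeFP (pairE termCtxE natE) natE (fun q => q.1.2.1.1) := (fst _ _).snd'.fst'.fst'
  have hb : CodeFP (pairE termCtxE natE) natE (fun q => q.1.2.1.2) := (fst _ _).snd'.fst'.snd'
  have hu : CodeFP (pairE termCtxE natE) natE (fun q => q.1.2.2.1) := (fst _ _).snd'.snd'.fst'
  have hv : CodeFP (pairE termCtxE natE) natE (fun q => q.1.2.2.2) := (fst _ _).snd'.snd'.snd'
  have he : CodeFP (pairE termCtxE natE) natE (fun q => 2 * q.2 + 1) :=
    (natAdd.comp ((natMul.comp ((const _ 2).pair hk)).pair (const _ 1)) :)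
  have hku : CodeFP (pairE termCtxE natE) unE (fun q => min q.2 q.1.1) := (unOfNatMin.comp (hW.pair hk) :)
  have heu : CodeFP (pairE termCtxE natE) unE (fun q => min (2 * q.2 + 1) q.1.1) := (unOfNatMin.comp (hW.pair he) :)
  have hak : CodeFP (pairE termCtxE natE) natE (fun q => q.1.2.1.1 ^ (min q.2 q.1.1)) := (natPow.comp (ha.pair hku) :)
  have hbk : CodeFP (pairE termCtxE natE) natE (fun q => q.1.2.1.2 ^ (min q.2 q.1.1)) := (natPow.comp (hb.pair hku) :)
  have hue : CodeFP (pairE termCtxE natE) natE (fun q => q.1.2.2.1 ^ (min (2 * q.2 + 1) q.1.1)) := (natPow.comp (hu.pair heu) :)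
  have hve : CodeFP (pairE termCtxE natE) natE (fun q => q.1.2.2.2 ^ (min (2 * q.2 + 1) q.1.1)) := (natPow.comp (hv.pair heu) :)
  have hfac : CodeFP (pairE termCtxE natE) natE (fun q => (min q.2 q.1.1).factorial) := (codeFP_natFactorial.comp hku :)
  have hden : CodeFP (pairE termCtxE natE) natE
      (fun q => q.1.2.1.2 ^ (min q.2 q.1.1) * q.1.2.2.2 ^ (min (2 * q.2 + 1) q.1.1) * (min q.2 q.1.1).factorial * (2 * q.2 + 1)) :=
    (natMul.comp ((natMul.comp ((natMul.comp (hbk.pair hve)).pair hfac)).pair he) :)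
  have hmag : CodeFP (pairE termCtxE natE) intE
      (fun q => ((q.1.2.1.1 ^ (min q.2 q.1.1) * q.1.2.2.1 ^ (min (2 * q.2 + 1) q.1.1) : ℕ) : ℤ)) :=
    (intOfNat.comp (natMul.comp (hak.pair hue)) :)
  have hpar : CodeFP (pairE termCtxE natE) bitE (fun q => decide (q.2 % 2 = 0)) :=
    (natEq.comp ((natMod.comp (hk.pair (const _ 2))).pair (const _ 0)) :)
  have hsign : CodeFP (pairE termCtxE natE) intE (fun q => ((-1 : ℤ) ^ q.2 : ℤ)) :=
    (hpar.ite (const _ (1 : ℤ)) (const _ (-1 : ℤ))).congr fun q => by rw [MachinPi.neg_one_pow_eq_ite]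
  have hnum : CodeFP (pairE termCtxE natE) intE
      (fun q => ((-1 : ℤ) ^ q.2 * ((q.1.2.1.1 ^ (min q.2 q.1.1) * q.1.2.2.1 ^ (min (2 * q.2 + 1) q.1.1) : ℕ) : ℤ) : ℤ)) :=
    (intMul.comp (hsign.pair hmag) :)
  exact (ratOfIntNat.comp (hnum.pair hden)).congr fun _ => rfl

/-- **`⟨⟨⟨a, b⟩, ⟨u, v⟩⟩, 1ᴷ⟩ ↦ gaussSeriesQ a b u v K` is polynomial time.** [cite: Ko1991, §2] -/
theorem codeFP_gaussSeriesQ :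
    CodeFP (pairE (pairE (pairE natE natE) (pairE natE natE)) unE) encodeRat
      (fun q => gaussSeriesQ q.1.1.1 q.1.1.2 q.1.2.1 q.1.2.2 q.2) := by
  -- context `⟨1^{2K+1}, data⟩` and items `[0, K)`
  have hK : CodeFP (pairE (pairE (pairE natE natE) (pairE natE natE)) unE) unE (fun q => q.2) := snd _ _
  have hW : CodeFP (pairE (pairE (pairE natE natE) (pairE natE natE)) unE) unE (fun q => 2 * q.2 + 1) :=
    (unSucc.comp (unAdd.comp (hK.pair hK))).congr fun q => by simp; ring
  have hctx : CodeFP (pairE (pairE (pairE natE natE) (pairE natE natE)) unE) termCtxE (fun q => (2 * q.2 + 1, q.1)) :=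
    (hW.pair (fst _ _) :)
  have hmap := (map codeFP_seriesTermCapped).comp (hctx.pair (urange.comp hK))
  refine ((ratSum.comp hmap).congr fun q => ?_)
  unfold gaussSeriesQ
  congr 1
  refine List.map_congr_left fun k hk => ?_
  rw [List.mem_range] at hk
  unfold seriesTermQ
  simp only
  rw [min_eq_left (by omega), min_eq_left (by omega)]

/-- **`⟨⟨S, u⟩, ⟨1ᵖ, 1ᵁ⟩⟩ ↦ gaussFApprox S u p U` is polynomial time** (`π̃` by `MachinPi.codeFP_piApprox`,
the lowest-terms numerator/denominator of `π̃/S`, the unary size of `u`, then `codeFP_gaussSeriesQ`).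
[cite: Regev2009, §2 (p. 11)] [cite: Ko1991, §2] -/
theorem codeFP_gaussFApprox :
    CodeFP (pairE (pairE encodeRat natE) (pairE unE unE)) encodeRat
      (fun q => gaussFApprox q.1.1 q.1.2 q.2.1 q.2.2) := by
  have hS : CodeFP (pairE (pairE encodeRat natE) (pairE unE unE)) encodeRat (fun q => q.1.1) := (fst _ _).fst'
  have hu : CodeFP (pairE (pairE encodeRat natE) (pairE unE unE)) natE (fun q => q.1.2) := (fst _ _).snd'
  have hp : CodeFP (pairE (pairE encodeRat natE) (pairE unE unE)) unE (fun q => q.2.1) := (snd _ _).fst'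
  have hU : CodeFP (pairE (pairE encodeRat natE) (pairE unE unE)) unE (fun q => q.2.2) := (snd _ _).snd'
  have hB : CodeFP (pairE (pairE encodeRat natE) (pairE unE unE)) unE (fun q => Nat.size q.1.2) := (codeFP_sizeUn.comp hu :)
  have hp' : CodeFP (pairE (pairE encodeRat natE) (pairE unE unE)) unE (fun q => q.2.1 + 3 * Nat.size q.1.2 + 1) :=
    (unSucc.comp (unAdd.comp (hp.pair (unAdd.comp ((unAdd.comp (hB.pair hB)).pair hB))))).congr fun q => by
      show _ = _; ring
  have hcq : CodeFP (pairE (pairE encodeRat natE) (pairE unE unE)) encodeRat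
      (fun q => piApprox (q.2.1 + 3 * Nat.size q.1.2 + 1) / q.1.1) :=
    (ratDiv.comp ((MachinPi.codeFP_piApprox.comp hp').pair hS) :)
  have hnd := ratNumDen.comp hcq
  have ha : CodeFP (pairE (pairE encodeRat natE) (pairE unE unE)) natE
      (fun q => (piApprox (q.2.1 + 3 * Nat.size q.1.2 + 1) / q.1.1).num.natAbs) := (intNatAbs.comp hnd.fst' :)
  have hb : CodeFP (pairE (pairE encodeRat natE) (pairE unE unE)) natE
      (fun q => (piApprox (q.2.1 + 3 * Nat.size q.1.2 + 1) / q.1.1).den) := (hnd.snd' :)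
  have hK : CodeFP (pairE (pairE encodeRat natE) (pairE unE unE)) unE (fun q => 6 * q.2.2 + q.2.1 + Nat.size q.1.2 + 2) := by
    have h6 : CodeFP (pairE (pairE encodeRat natE) (pairE unE unE)) unE (fun q => 6 * q.2.2) := by
      have h2 : CodeFP (pairE (pairE encodeRat natE) (pairE unE unE)) unE (fun q => 2 * q.2.2) :=
        (unAdd.comp (hU.pair hU)).congr fun q => by simp; ring
      exact (unAdd.comp ((unAdd.comp (h2.pair h2)).pair h2)).congr fun q => by simp; ring
    exact (unSucc.comp (unSucc.comp (unAdd.comp ((unAdd.comp (h6.pair hp)).pair hB)))).congr fun q => rfl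
  have hdata : CodeFP (pairE (pairE encodeRat natE) (pairE unE unE)) (pairE (pairE (pairE natE natE) (pairE natE natE)) unE)
      (fun q => ((((piApprox (q.2.1 + 3 * Nat.size q.1.2 + 1) / q.1.1).num.natAbs,
          (piApprox (q.2.1 + 3 * Nat.size q.1.2 + 1) / q.1.1).den), (q.1.2, 1)), 6 * q.2.2 + q.2.1 + Nat.size q.1.2 + 2)) :=
    (((ha.pair hb).pair (hu.pair (const _ 1))).pair hK :)
  exact (codeFP_gaussSeriesQ.comp hdata).congr fun _ => rfl

end GaussIntegral

end Literature.Computability.Complexity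

end
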